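import Literature.Topology.PlaneTopology.OsgoodFatLoop
import Mathlib.MeasureTheory.Measure.Lebesgue.EqHaar
import HarnessLib

/-!
# The branches of the fat loop of an Osgood arc have positive area at every scale

Topic: Topology / PlaneTopology, sequel to `OsgoodFatLoop.lean` (the fat Jordan loop
`OsgoodDomain.fatLoop γ` of an Osgood arc `γ`, `IsOsgoodArc γ`). The right branch of the loop at
its base point `0 = fatLoop γ 0` is the geometric chain of the dyadic copies
`2⁻ⁿ • fatPiece γ [0, 1]`, and each piece contains the similar copy `3/4 + γ/4` of the arc; so

* `exists_fatBranch_eq_smul`, `smul_fatPiece_mem_range` — the points `2⁻ⁿ • fatPiece γ θ` are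
  values of the right branch at parameters in `[2⁻ⁿ⁻¹, 2⁻ⁿ]`, on the loop, and so are their
  mirror images `-conj (2⁻ⁿ • fatPiece γ θ)` (on the left branch);
* `volume_image_Ioo_pos` — **every boundary arc `fatLoop γ '' (0, ε)` has positive planar
  Lebesgue measure**: it contains `2⁻ⁿ • (3/4 + γ [0, 1] / 4)` for `2⁻ⁿ < ε`, of measure
  `4⁻ⁿ · 16⁻¹ · volume (γ [0, 1]) > 0` (`Measure.addHaar_smul`, `Measure.addHaar_image_homothety`);
* `volume_image_Ioo_neg_pos` — so has every arc `fatLoop γ '' (-ε, 0)`: by periodicity it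
  contains the mirror image of `fatLoop γ '' (0, min ε ¼)` under the linear isometry
  `z ↦ -conj z` of `ℂ ≅ ℝ²`, which preserves Lebesgue measure
  (`LinearIsometryEquiv.measurePreserving`).

Everything is elementary and [folklore] (W. F. Osgood, *A Jordan curve of positive area*,
Trans. AMS 4 (1903), 107–112). Deliberately NOT here: the Jordan domain bounded by the loop
(`OsgoodFatDomain.lean`).
-/

noncomputable section

open Set Function Complex _root_.MeasureTheory
open scoped ComplexConjugate Pointwise

namespace Literature.Topology.PlaneTopology

namespace OsgoodDomain

variable {γ : ℝ → ℂ}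

/-! ### Dyadic copies of the piece on the loop -/

/-- **The points `2⁻ⁿ • fatPiece γ θ` are on the right branch**, at parameters in
`[2⁻ⁿ⁻¹, 2⁻ⁿ]`. [folklore] -/
theorem exists_fatBranch_eq_smul (h : IsOsgoodArc γ) (n : ℕ) {θ : ℝ} (hθ : θ ∈ Icc (0 : ℝ) 1) :
    ∃ t ∈ Icc (((2 : ℝ) ^ (n + 1))⁻¹) (((2 : ℝ) ^ n)⁻¹),
      fatBranch γ t = ((2 : ℝ) ^ n)⁻¹ • fatPiece γ θ := by
  have hmem : ((2 : ℝ) ^ n)⁻¹ • fatPiece γ θ ∈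
      geomChain (fatPiece γ) '' Icc (((2 : ℝ) ^ (n + 1))⁻¹) (((2 : ℝ) ^ n)⁻¹) := by
    rw [image_geomChain_Icc_nat (fatPiece_junction h) n]
    exact smul_mem_smul_set (mem_image_of_mem _ hθ)
  obtain ⟨t, ht, hval⟩ := hmem
  exact ⟨t, ht, hval⟩

/-- The dyadic parameter blocks `[2⁻ⁿ⁻¹, 2⁻ⁿ]` lie in `(0, 1]`. [folklore] -/
theorem dyadic_Icc_subset_Ioc (n : ℕ) :
    Icc (((2 : ℝ) ^ (n + 1))⁻¹) (((2 : ℝ) ^ n)⁻¹) ⊆ Ioc (0 : ℝ) 1 := fun _ ht =>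
  ⟨lt_of_lt_of_le (by positivity) ht.1, ht.2.trans (inv_le_one_of_one_le₀ (one_le_pow₀ one_le_two))⟩

/-- The points `2⁻ⁿ • fatPiece γ θ` and their mirror images `-conj (2⁻ⁿ • fatPiece γ θ)` are on
the loop. [folklore] -/
theorem smul_fatPiece_mem_range (h : IsOsgoodArc γ) (n : ℕ) {θ : ℝ} (hθ : θ ∈ Icc (0 : ℝ) 1) :
    ((2 : ℝ) ^ n)⁻¹ • fatPiece γ θ ∈ range (fatLoop γ) ∧
      -conj (((2 : ℝ) ^ n)⁻¹ • fatPiece γ θ) ∈ range (fatLoop γ) := by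
  obtain ⟨t, ht, hval⟩ := exists_fatBranch_eq_smul h n hθ
  have ht' := dyadic_Icc_subset_Ioc n ht
  refine ⟨hval ▸ fatBranch_mem_range h ⟨ht'.1.le, ht'.2⟩, ?_⟩
  have : fatBranch' γ (1 - t) = -conj (((2 : ℝ) ^ n)⁻¹ • fatPiece γ θ) := by
    rw [fatBranch', sub_sub_cancel, hval]
  exact this ▸ fatBranch'_mem_range h ⟨by linarith [ht'.2], by linarith [ht'.1]⟩

/-! ### Positive area of the boundary arcs at `0` -/

/-- The similar copy `3/4 + γ s / 4` of a point of the arc is the point `fatPiece γ ((1 - s)/2)`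
of the piece. [folklore] -/
theorem homothety_eq_fatPiece {s : ℝ} (hs : s ∈ Icc (0 : ℝ) 1) :
    AffineMap.homothety (1 : ℂ) (1 / 4 : ℝ) (γ s) = fatPiece γ ((1 - s) / 2) := by
  rw [AffineMap.homothety_apply, fatPiece_of_le (by linarith [hs.1]),
    show 1 - 2 * ((1 - s) / 2) = s by ring, vsub_eq_sub, vadd_eq_add, smul_sub, Complex.real_smul,
    Complex.real_smul]
  push_cast
  ring

/-- **Every boundary arc `fatLoop γ '' (0, ε)` has positive area**: it contains the copy
`2⁻ⁿ • (3/4 + γ [0, 1] / 4)` of the Osgood arc for `2⁻ⁿ < ε`. [folklore] -/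
theorem volume_image_Ioo_pos (h : IsOsgoodArc γ) {ε : ℝ} (hε : 0 < ε) :
    0 < volume (fatLoop γ '' Ioo 0 ε) := by
  obtain ⟨n, hn⟩ := exists_pow_lt_of_lt_one hε (by norm_num : (1 / 2 : ℝ) < 1)
  rw [one_div, inv_pow] at hn
  set A : Set ℂ := ((2 : ℝ) ^ n)⁻¹ • (AffineMap.homothety (1 : ℂ) (1 / 4 : ℝ) '' (γ '' Icc 0 1))
    with hA
  have hsub : A ⊆ fatLoop γ '' Ioo 0 ε := by
    rintro _ ⟨_, ⟨_, ⟨s, hs, rfl⟩, rfl⟩, rfl⟩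
    have hθ : (1 - s) / 2 ∈ Icc (0 : ℝ) 1 := ⟨by linarith [hs.2], by linarith [hs.1]⟩
    obtain ⟨t, ht, hval⟩ := exists_fatBranch_eq_smul h n hθ
    have ht' := dyadic_Icc_subset_Ioc n ht
    refine ⟨t / 4, ⟨by linarith [ht'.1], by linarith [ht.2]⟩, ?_⟩
    rw [fatLoop_of_mem_first h ⟨by linarith [ht'.1], by linarith [ht'.2]⟩,
      show 4 * (t / 4) = t by ring, homothety_eq_fatPiece hs]
    exact hval
  have hvol : volume A = ENNReal.ofReal |(((2 : ℝ) ^ n)⁻¹) ^ Module.finrank ℝ ℂ| *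
      (ENNReal.ofReal |(1 / 4 : ℝ) ^ Module.finrank ℝ ℂ| * volume (γ '' Icc 0 1)) := by
    rw [hA, Measure.addHaar_smul, Measure.addHaar_image_homothety]
  have hApos : 0 < volume A := by
    rw [hvol]
    refine ENNReal.mul_pos (ENNReal.ofReal_pos.2 (abs_pos.2 (pow_ne_zero _ (by positivity)))).ne'
      (ENNReal.mul_pos (ENNReal.ofReal_pos.2 (by positivity)).ne' h.volume_pos.ne').ne'
  exact lt_of_lt_of_le hApos (measure_mono hsub)

/-- **Every boundary arc `fatLoop γ '' (-ε, 0)` has positive area**: it contains the mirror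
image under the measure-preserving reflection `z ↦ -conj z` of the arc
`fatLoop γ '' (0, min ε ¼)`. [folklore] -/
theorem volume_image_Ioo_neg_pos (h : IsOsgoodArc γ) {ε : ℝ} (hε : 0 < ε) :
    0 < volume (fatLoop γ '' Ioo (-ε) 0) := by
  have hε' : 0 < min ε (1 / 4) := lt_min hε (by norm_num)
  set e : ℂ ≃ₗᵢ[ℝ] ℂ := Complex.conjLIE.trans (LinearIsometryEquiv.neg ℝ) with he
  have he' : ∀ z, e z = -conj z := fun z => rfl
  have hsub : e '' (fatLoop γ '' Ioo 0 (min ε (1 / 4))) ⊆ fatLoop γ '' Ioo (-ε) 0 := by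
    rintro _ ⟨_, ⟨t, ht, rfl⟩, rfl⟩
    have htε : t < ε := ht.2.trans_le (min_le_left _ _)
    have ht4 : t ≤ 1 / 4 := (ht.2.trans_le (min_le_right _ _)).le
    refine ⟨-t, ⟨by linarith, by linarith [ht.1]⟩, ?_⟩
    have harg : 1 - (4 * (-t + 1) - 3) = 4 * t := by ring
    rw [← (isJordanLoop_fatLoop h).periodic (-t),
      fatLoop_of_mem_fourth h ⟨by linarith, by linarith [ht.1]⟩,
      fatLoop_of_mem_first h ⟨ht.1.le, ht4⟩, he', fatBranch', harg]
  have hvol : volume (e '' (fatLoop γ '' Ioo 0 (min ε (1 / 4)))) =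
      volume (fatLoop γ '' Ioo 0 (min ε (1 / 4))) := by
    rw [e.image_eq_preimage_symm]
    exact e.symm.measurePreserving.measure_preimage_emb e.symm.toHomeomorph.measurableEmbedding _
  have hpos := volume_image_Ioo_pos h hε'
  rw [← hvol] at hpos
  exact lt_of_lt_of_le hpos (measure_mono hsub)

end OsgoodDomain

end Literature.Topology.PlaneTopology
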